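import Literature.AnabelianGeometry.EtaleTheta.Discharge.Sec5Cor512ModelCase
import Literature.AnabelianGeometry.EtaleTheta.Discharge.Sec5Cor512UniversalClosureRefuted
import Literature.AnabelianGeometry.EtaleTheta.ThetaFrobenioidOfModel
import Literature.AlgebraicGeometry.Frobenioids.DegreeModelFrobenioid
import Mathlib.CategoryTheory.SingleObj
import Mathlib.Topology.Instances.ZMod
import Mathlib.Algebra.Field.ZMod
import HarnessLib

/-!
# [EtTh] Corollary 5.12 (i) at a model Frobenioid: the input "every `D`-endomorphism of `B_N^bs` is an isomorphism"
# of the model-case closer CANNOT BE DROPPED (kernel counter-model over a base with a Frobenius-like endomorphism)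

Mochizuki, *The étale theta function and its Frobenioid-theoretic manifestations*, Publ. RIMS **45** (2009),
Corollary 5.12 (i) p.339 (PDF p.113) and its proof p.340 l.−8 – p.341 l.9 (PDF pp.114–115)
[cite: MochizukiEtTh2009, Cor 5.12 (i) p.339–341 (PDF pp.113–115)]; *The geometry of Frobenioids I*, Kyushu J.
Math. **62** (2008), Thm. 5.2 [cite: MochizukiFrdI2008, Thm. 5.2 p.100–101].

abc-iut cell, block F, seat abc-iut-f-112 (gen 2); second sequel of `Discharge/Sec5Cor512ModelCase.lean` (p436682),
FACT-LIST row F-0505 (`ConstantMultiple.IsoClassesDistinct`).  There, `RootMorphismData.isoClassesDistinct_of_model`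
derives Cor. 5.12 (i) for §5 data over `ModelFrobenioid Φ B Div_B` from the inputs NAMED in the printed proof —
`A_N` Frobenius-trivial; "all positive tensor powers of these line bundles are nontrivial"; "the isomorphism classes
of these line bundles are preserved by arbitrary automorphisms of `B^bs_N`" (= Aut-ampleness of `B_N`, p.330); the
isometry `β_{N,N'}` of degree `M ≥ 2` — plus ONE input print does not name, `hEnd`: every `D`-endomorphism of `B_N^bs`
is an isomorphism.  THIS FILE PROVES (kernel) that `hEnd` cannot be dropped from that list:

* `Cor512EndToy.Φpow` — on the one-object base `D = SingleObj (ℕ,+)` (endomorphisms `φ^n`, only `φ^0` invertible)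
  the divisor monoid `(ℕ,+)` with `Φ(φ^n) = ` multiplication by `2^n` (a "Frobenius-like" base endomorphism acting
  on divisors by the degree); `B = 0`, `Div_B = 0`; `C := ModelFrobenioid Φpow B DivB`;
* `thetaEnd : ThetaFrobenioid C D`, `rootEnd : RootMorphismData thetaEnd vocabEnd` — `A_N = A_{N'} := (⋆, 0)`,
  **`B_N = B_{N'} := (⋆, 1)`**, `s := (1, id, 1, ·)`, `α_{N,N'} := (2, φ, 0, ·) : A → A`,
  **`β_{N,N'} := (2, φ, 0, ·) : B → B`** — an isometry of Frobenius degree `2` from `B_{N'}` to `B_N` over the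
  non-invertible `φ` (relation (d): `2·1 = φ^*(1) = 2`), the squares commuting;
* ALL the other binders of `isoClassesDistinct_of_model` HOLD (`thetaEnd_pre`, `isDivisorial_Φpow`,
  `isFrobeniusTrivial_A`, `autAmpleBN_End` — `Aut_D(⋆) = {φ^0}` —, `cls_B_ne`, `cls_B_pow_ne`), yet
  **`not_isoClassesDistinct_rootEnd`**: (i) FAILS (`B_N = B_{N'}`); and `not_isIso_φ`: `hEnd` fails;
* **`not_isoClassesDistinct_of_model_without_hEnd`** — the universal statement "`isoClassesDistinct_of_model`
  without `hEnd`" is FALSE.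

WHY THIS IS THE RIGHT DIAGNOSIS (Cor. 5.12 proof, p.341 l.5–9): an isomorphism `h : B_N ⥲ B_{N'}` composed with
`β_{N,N'}` is an isometric endomorphism of `B_N` of degree `M` lying over the `D`-ENDOmorphism `h^bs ∘ β^bs`; print's
"preserved by arbitrary AUTOmorphisms of `B^bs_N`" disposes of it only when that endomorphism is invertible — true for
the connected tempered coverings of §5 (and supplied as `hEnd` in p436682), false here.  HONEST LABEL: DEGENERATE
counter-model (one base object, `B = 0`, trivial Galois data, trivially-true bi-Kummer vocabulary) built only to
separate the hypotheses of OUR model-case closer; it says nothing about the theta Frobenioid of a curve, where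
`hEnd` holds; nothing here bears on [IUTchIII] Cor. 3.12; no side taken; typed ≠ proved except the theorems below.
-/

noncomputable section

namespace Literature.AnabelianGeometry.EtaleTheta

namespace ConstantMultiple

namespace Cor512EndToy

open CategoryTheory Opposite
open Literature.AlgebraicGeometry.Frobenioids
open Cor512Toy (Mm kerFstEquiv)

/-! ### The base `D = SingleObj (ℕ,+)` and the divisor monoid `Φ(φ^n) = (·)^{2^n}` on `(ℕ,+)` -/

/-- The endomorphism monoid `(ℕ,+)` of the one base object (written multiplicatively): `φ^n`.
[cite: MochizukiFrdI2008, Def. 1.1 (ii) p.19] -/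
abbrev E : Type := Multiplicative ℕ

/-- The one-object base category with `End(⋆) = (ℕ,+)`. [cite: MochizukiFrdI2008, Def. 1.1 (ii) p.19] -/
abbrev D : Type := SingleObj E

/-- Its object. [cite: MochizukiFrdI2008, Def. 1.1 (ii) p.19] -/
abbrev pt : D := SingleObj.star E

/-- An arrow of `D` read as an element of `(ℕ,+)` (the identity map; arrows of `SingleObj E` ARE elements of `E`).
[cite: MochizukiFrdI2008, Def. 1.1 (ii) p.19] -/
def toE {X Y : D} (f : X ⟶ Y) : E := f

/-- The exponent `n` of an arrow `φ^n` of `D`. [cite: MochizukiFrdI2008, Def. 1.1 (ii) p.19] -/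
def expo {X Y : D} (f : X ⟶ Y) : ℕ := Multiplicative.toAdd (toE f)

/-- `toE (id) = 1`. [cite: MochizukiFrdI2008, Def. 1.1 (ii) p.19] -/
theorem toE_id (X : D) : toE (𝟙 X) = 1 := rfl

/-- `toE (a ; b) = toE b · toE a`. [cite: MochizukiFrdI2008, Def. 1.1 (ii) p.19] -/
theorem toE_comp {X Y Z : D} (a : X ⟶ Y) (b : Y ⟶ Z) : toE (a ≫ b) = toE b * toE a := rfl

/-- `expo (id) = 0`. [cite: MochizukiFrdI2008, Def. 1.1 (ii) p.19] -/
theorem expo_id (X : D) : expo (𝟙 X) = 0 := rfl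

/-- `expo (a ; b) = expo b + expo a`. [cite: MochizukiFrdI2008, Def. 1.1 (ii) p.19] -/
theorem expo_comp {X Y Z : D} (a : X ⟶ Y) (b : Y ⟶ Z) : expo (a ≫ b) = expo b + expo a := rfl

/-- The generating endomorphism `φ = φ^1` of `⋆` (not invertible). [cite: MochizukiFrdI2008, Def. 1.1 (ii) p.19] -/
def φ : pt ⟶ pt := (Multiplicative.ofAdd (1 : ℕ) : E)

/-- `toE φ = φ^1`. [cite: MochizukiFrdI2008, Def. 1.1 (ii) p.19] -/
theorem toE_φ : toE φ = Multiplicative.ofAdd 1 := rfl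

/-- `expo φ = 1`. [cite: MochizukiFrdI2008, Def. 1.1 (ii) p.19] -/
theorem expo_φ : expo φ = 1 := rfl

/-- The divisor monoid on `D`: value `(ℕ,+)` (abc-iut-L1-d4's `DegreeModel.N`), `Φ(φ^n) :=` the `2^n`-th power map
("pull-back along the Frobenius-like `φ` multiplies degrees by `2`").  [cite: MochizukiFrdI2008, Def. 1.1 (ii) p.19] -/
abbrev Φpow : Dᵒᵖ ⥤ CommMonCat.{0} where
  obj _ := CommMonCat.of DegreeModel.N
  map f := CommMonCat.ofHom (powMonoidHom (2 ^ expo f.unop))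
  map_id X := by
    apply CommMonCat.hom_ext
    apply MonoidHom.ext
    intro x
    change x ^ (2 ^ expo (𝟙 (unop X))) = x
    rw [expo_id, pow_zero, pow_one]
  map_comp f g := by
    apply CommMonCat.hom_ext
    apply MonoidHom.ext
    intro x
    change x ^ (2 ^ expo (g.unop ≫ f.unop)) = (x ^ (2 ^ expo f.unop)) ^ (2 ^ expo g.unop)
    rw [expo_comp, pow_add, pow_mul]

/-- `Φ(φ)` is squaring: `φ^* x = 2·x`. [cite: MochizukiFrdI2008, Def. 1.1 (ii) p.19] -/
theorem pull_φ (x : DegreeModel.N) : pull Φpow φ x = x ^ 2 := by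
  change x ^ (2 ^ expo φ) = x ^ 2
  rw [expo_φ, pow_one]

/-- `Φ` is objectwise divisorial (`(ℕ,+)`, abc-iut-L1-d4's `isDivisorial_N`). [cite: MochizukiFrdI2008, Def. 1.1 (i) p.19] -/
theorem isDivisorial_Φpow : Objectwise (fun M _ => IsDivisorial M) Φpow := fun _ => DegreeModel.isDivisorial_N

/-- `Φ` is objectwise integral. [cite: MochizukiFrdI2008, Def. 1.1 (i) p.19] -/
theorem isIntegral_Φpow : ∀ A : Dᵒᵖ, IsIntegral (Φpow.obj A) :=
  fun A => (isDivisorial_Φpow A.unop).isPreDivisorial.isIntegral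

/-- The rational function monoid `B = 0_D`. [cite: MochizukiFrdI2008, Thm. 5.2 p.100] -/
abbrev B : Dᵒᵖ ⥤ CommMonCat.{0} := zeroMonoid D

/-- The values of `B` have one element. [cite: MochizukiFrdI2008, Prop. 4.4 (i) p.83] -/
theorem subsingleton_B_obj (A : Dᵒᵖ) : Subsingleton (B.obj A) := inferInstanceAs (Subsingleton PUnit)

/-- `B = 0_D` is objectwise group-like. [cite: MochizukiFrdI2008, Def. 1.1 (i) p.19] -/
theorem isGroupLike_B : Objectwise (fun M _ => IsGroupLike M) B := fun A =>
  haveI := subsingleton_B_obj (op A)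
  DegreeModel.isGroupLike_of_subsingleton (B.obj (op A))

/-- `Div_B = 0 : B → Φ^gp`. [cite: MochizukiFrdI2008, Thm. 5.2 p.100] -/
def DivB : B ⟶ monoidGp Φpow where
  app _ := CommMonCat.ofHom 1
  naturality X Y f := by
    apply CommMonCat.hom_ext
    apply MonoidHom.ext
    intro x
    change (1 : B.obj Y →* (monoidGp Φpow).obj Y) ((B.map f).hom x) =
      ((monoidGp Φpow).map f).hom ((1 : B.obj X →* (monoidGp Φpow).obj X) x)
    rw [MonoidHom.one_apply, MonoidHom.one_apply, map_one]

/-- `Div_B(u) = 0`. [cite: MochizukiFrdI2008, Thm. 5.2 p.100] -/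
@[simp] theorem divB_eq_one (A : Dᵒᵖ) (u : B.obj A) : divB Φpow B DivB A u = 1 := rfl

/-- The model Frobenioid `C` of `(D, Φ, B, Div_B)` ([FrdI] Thm. 5.2 (i)): objects `(⋆, c)`, `c ∈ ℕ^gp`.
[cite: MochizukiFrdI2008, Thm. 5.2 (i) p.100] -/
abbrev C : Type := ModelFrobenioid Φpow B DivB

/-- The degree-`1` effective divisor `1 ∈ (ℕ,+)`. [cite: MochizukiFrdI2008, Thm. 5.2 (i) p.100] -/
def one1 : DegreeModel.N := Multiplicative.ofAdd (1 : ℕ)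

/-- `φ^* 1 = 2` on divisors. [cite: MochizukiFrdI2008, Def. 1.1 (ii) p.19] -/
theorem pull_φ_one1 : pull Φpow φ one1 = one1 ^ 2 := pull_φ one1

/-- The generator `1 ∈ ℕ ⊆ ℕ^gp` (the class of "a line bundle of degree `1`"). [cite: MochizukiFrdI2008, Thm. 5.2 (i) p.100] -/
def gen : Algebra.GrothendieckGroup DegreeModel.N := Algebra.GrothendieckGroup.of one1

/-- `φ^* gen = 2·gen`. [cite: MochizukiFrdI2008, Thm. 5.2 (i) p.100] -/
theorem pullGp_φ_gen : pullGp Φpow φ gen = gen ^ 2 := by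
  unfold gen
  rw [PreFrobenioid.pullGp_of', pull_φ_one1, map_pow]

/-- No positive power of `gen` is trivial (degree `k ≠ 0`, via abc-iut-L1-d4's `DegreeModel.deg`).
[cite: MochizukiFrdI2008, Thm. 5.2 (i) p.100] -/
theorem gen_pow_ne_one (k : ℕ) (hk : 0 < k) : gen ^ k ≠ 1 := by
  intro h
  have hk' : Multiplicative.toAdd (DegreeModel.deg (gen ^ k)) = Multiplicative.toAdd (DegreeModel.deg 1) :=
    congrArg (fun c => Multiplicative.toAdd (DegreeModel.deg c)) h
  unfold gen one1 at hk'
  rw [map_pow, DegreeModel.deg_of, toAdd_pow, toAdd_ofAdd, toAdd_ofAdd, map_one, toAdd_one, Nat.cast_one,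
    nsmul_eq_mul, mul_one] at hk'
  omega

/-- The object `A = (⋆, 0)` (plays `A_N = A_{N'}`: the zero section). [cite: MochizukiEtTh2009, §5 p.330 (PDF p.104)] -/
abbrev A : C := ⟨pt, 1⟩

/-- The object `B = (⋆, 1)` (plays BOTH `B_N` and `B_{N'}`). [cite: MochizukiEtTh2009, Cor 5.12 p.339 (PDF p.113)] -/
abbrev Bo : C := ⟨pt, gen⟩

/-- `s = (1, id, 1, ·) : A → B` (plays `s^⊓_N = s^⊔_N = s^⊓_{N'} = s^⊔_{N'}`): relation `0 + 1 = 1`.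
[cite: MochizukiEtTh2009, §5 p.330 (PDF p.104)] -/
def s : A ⟶ Bo :=
  ModelFrobenioid.mkHom A Bo 1 (𝟙 pt) one1 1 (by
    rw [one_pow, one_mul, pullGp_id, divB_eq_one, mul_one]
    rfl)

/-- `α = (2, φ, 0, ·) : A → A` (plays `α_{N,N'}`): relation `2·0 = φ^*0`.  [cite: MochizukiEtTh2009, Cor 5.12 p.339 (PDF p.113)] -/
def αE : A ⟶ A :=
  ModelFrobenioid.mkHom A A 2 φ 1 1 (by rw [one_pow, map_one, map_one, divB_eq_one, mul_one])

/-- `β = (2, φ, 0, ·) : B → B` (plays `β_{N,N'} : B_{N'} → B_N`): relation `2·1 = φ^*1 = 2` — an isometry of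
Frobenius degree `2` over the NON-invertible base endomorphism `φ`.  [cite: MochizukiEtTh2009, Cor 5.12 p.339 (PDF p.113)] -/
def βE : Bo ⟶ Bo :=
  ModelFrobenioid.mkHom Bo Bo 2 φ 1 1 (by
    rw [map_one, mul_one, divB_eq_one, mul_one]
    exact pullGp_φ_gen.symm)

/-- The square `s ; β = α ; s` (both composites are `(2, φ, 2, ·) : A → B`; arrows compared componentwise).
[cite: MochizukiEtTh2009, Cor 5.12 p.339 (PDF p.113)] -/
theorem s_comp_βE : s ≫ βE = αE ≫ s := by
  haveI := subsingleton_B_obj (op A.base)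
  refine ModelFrobenioid.hom_ext (by decide) ?_ ?_ (Subsingleton.elim _ _)
  · change 𝟙 pt ≫ φ = φ ≫ 𝟙 pt
    rw [Category.id_comp, Category.comp_id]
  · rw [ModelFrobenioid.div_comp_pull, ModelFrobenioid.div_comp_pull]
    simp only [s, αE, βE, ModelFrobenioid.div_mkHom, ModelFrobenioid.baseMap_mkHom, ModelFrobenioid.degFr_mkHom,
      map_one, one_mul, one_pow, mul_one]
    rfl

/-! ### The §5 datum and the Corollary 5.12 datum over `C` -/

/-- The Frobenioid-level §5 vocabulary of `C` = the model's (abc-iut-L2-t9's `TemperedFrobenioidStub.ofModel`).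
[cite: MochizukiEtTh2009, Def 3.6 p.303 (PDF p.77)] -/
def stubEnd : FrobenioidTheta.TemperedFrobenioidStub.{0} C D :=
  FrobenioidTheta.TemperedFrobenioidStub.ofModel Φpow B DivB isIntegral_Φpow ⊤

/-- `Aut_D(⋆)` is trivial: an invertible element of `(ℕ,+)` is `0`. [cite: MochizukiFrdI2008, §0 p.11] -/
theorem toE_aut_hom (g : Aut pt) : toE g.hom = 1 := by
  have h : toE g.inv * toE g.hom = 1 := congrArg toE g.hom_inv_id
  exact DegreeModel.eq_one_of_isUnit_N _ (IsUnit.of_mul_eq_one_right _ h)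

/-- Hence every `g ∈ Aut_D(⋆)` is the identity. [cite: MochizukiFrdI2008, §0 p.11] -/
theorem aut_eq_one (g : Aut pt) : g = 1 := Aut.ext (toE_aut_hom g)

/-- **The §5 datum over `C`**: `A_⊚ = A_N := A`, `B_N := B`, `s^⊓_N = s^⊔_N := s`, `N = l = 1`, `Π^tp_X = ℤ × ℤ/2`,
`Π^tp_Ÿ = 1`, `K = 𝔽₂`, trivial sections and constants (as in gen 0's toys; every field supplied).
[cite: MochizukiEtTh2009, §5 p.322–331 (PDF pp.96–105)] -/
def thetaEnd : ThetaFrobenioid.{0} C D where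
  toTemperedFrobenioidStub := stubEnd
  lDelta := fun _ => Unit
  lDeltaMap := fun _ => MonoidHom.id Unit
  l := 1
  odd_l := odd_one
  N := 1
  Acirc := A
  AN := A
  BN := Bo
  sCap := s
  sCup := s
  base_map_sCap := rfl
  isPreStep_sCap := ⟨rfl, by change IsIso (𝟙 pt); infer_instance⟩
  isPreStep_sCup := ⟨rfl, by change IsIso (𝟙 pt); infer_instance⟩
  PiX := Multiplicative ℤ × Mm
  zquot := MonoidHom.fst _ _
  zquot_surjective := fun z => ⟨(z, 1), rfl⟩
  PiYdd := ⊥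
  PiYdd_le := bot_le
  relindex_PiYdd := by
    rw [Subgroup.relIndex_bot_left, Nat.card_congr kerFstEquiv, Nat.card_zmod]
  PiYdd_normal := inferInstance
  isOpen_PiYdd := isOpen_discrete _
  ρ := 1
  ρ_surjective := fun g => ⟨1, by rw [map_one]; exact (aut_eq_one g).symm⟩
  isOpen_ker_ρ := isOpen_discrete _
  strv := 1
  sgpCap := 1
  sgpCup := 1
  K := ZMod 2
  constEmb := 1
  constEmb_injective := by
    intro a b _
    have h : ∀ u : (ZMod 2)ˣ, u = 1 := by decide
    rw [h a, h b]
  thetaFn := 1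

/-- The trivially-true bi-Kummer vocabulary (not consulted by Cor. 5.12 (i)). [cite: MochizukiEtTh2009, Prop 5.2 p.324 (PDF p.98)] -/
def vocabEnd : FrobenioidThetaBiKummer.BiKummerVocabStub thetaEnd where
  IsRootOfRightFractionPair := fun _ _ _ _ _ _ _ => True
  IsRootOf := fun _ _ _ _ _ => True

/-- **The Corollary 5.12 datum**: `N' = 2` (`M = 2 ≠ 1`), `A_{N'} := A`, **`B_{N'} := B = B_N`**, `s^⊓_{N'} = s^⊔_{N'} := s`,
`α_{N,N'} := αE`, `β_{N,N'} := βE` (isometries of degree `2`; `α` "of base-Frobenius type" — the stub class is `⊤`).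
[cite: MochizukiEtTh2009, Cor 5.12 p.339 (PDF p.113)] -/
def rootEnd : RootMorphismData thetaEnd vocabEnd where
  N' := 2
  dvd := ⟨2, rfl⟩
  ne := by decide
  AN' := A
  BN' := Bo
  sCap' := s
  sCup' := s
  isRoot := ⟨A, 1, trivial, trivial⟩
  α := αE
  β := βE
  comm_sCap := s_comp_βE
  comm_sCup := s_comp_βE
  isIsometry_α := rfl
  degFr_α := rfl
  isIsometry_β := rfl
  degFr_β := rfl
  baseFrob_α := trivial
  constEmb' := 1

/-! ### Every binder of `isoClassesDistinct_of_model` except `hEnd` holds; `hEnd` and the conclusion fail -/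

/-- `h𝔉`: the datum's operations are the model's (`rfl`). [cite: MochizukiEtTh2009, Def 3.6 p.303 (PDF p.77)] -/
theorem thetaEnd_pre : thetaEnd.pre = PreFrobenioidData.ofModel Φpow B DivB := rfl

/-- `A_N = A = (⋆, 0)` is Frobenius-trivial (the zero section, [FrdI] Thm. 5.2 proof p.101).
[cite: MochizukiFrdI2008, Thm. 5.2 p.101] -/
theorem isFrobeniusTrivial_A : thetaEnd.IsFrobeniusTrivial thetaEnd.AN := by
  show (PreFrobenioidData.ofModel Φpow B DivB).IsFrobeniusTrivial A
  exact (PreFrobenioidData.ofFunctor_isFrobeniusTrivial _ _).mpr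
    (ModelFrobenioid.isFrobeniusTrivial_of_cls_eq_one isGroupLike_B A rfl)

/-- `B_N` is Aut-ample (`Aut_D(⋆)` is trivial). [cite: MochizukiEtTh2009, §5 p.330 (PDF p.104)] -/
theorem autAmpleBN_End : thetaEnd.AutAmpleBN := fun g => ⟨1, by rw [map_one]; exact (aut_eq_one g).symm⟩

/-- "The line bundle of `B_N` is nontrivial": `cls(B) = gen ≠ 0 = Div_B(u)`. [cite: MochizukiEtTh2009, Cor 5.12 proof p.341 (PDF p.115)] -/
theorem cls_B_ne (u : B.obj (op thetaEnd.BN.base)) : thetaEnd.BN.cls ≠ divB Φpow B DivB (op thetaEnd.BN.base) u := by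
  intro h
  have h' : gen ^ 1 = 1 := by rw [pow_one]; exact h
  exact gen_pow_ne_one 1 one_pos h'

/-- "All positive tensor powers of the line bundle of `B_{N'}` are nontrivial": `k·gen ≠ 0 = Div_B(u)`, `k ≥ 1`.
[cite: MochizukiEtTh2009, Cor 5.12 proof p.341 (PDF p.115)] -/
theorem cls_B_pow_ne (k : ℕ) (hk : 0 < k) (u : B.obj (op rootEnd.BN'.base)) :
    rootEnd.BN'.cls ^ k ≠ divB Φpow B DivB (op rootEnd.BN'.base) u :=
  fun h => gen_pow_ne_one k hk h

/-- **`hEnd` FAILS**: the base endomorphism `φ` of `B_N^bs = ⋆` is not an isomorphism.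
[cite: MochizukiEtTh2009, Cor 5.12 proof p.341 (PDF p.115)] -/
theorem not_isIso_φ : ¬ IsIso φ := by
  intro hφ
  have h : toE (inv φ) * toE φ = 1 := congrArg toE (IsIso.hom_inv_id φ)
  have h1 : toE φ = 1 := DegreeModel.eq_one_of_isUnit_N _ (IsUnit.of_mul_eq_one_right _ h)
  exact Nat.one_ne_zero (congrArg Multiplicative.toAdd h1)

/-- Hence NOT every `D`-endomorphism of `B_N^bs` is an isomorphism (the binder `hEnd` of p436682 fails here).
[cite: MochizukiEtTh2009, Cor 5.12 proof p.341 (PDF p.115)] -/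
theorem not_hEnd : ¬ ∀ ψ : thetaEnd.base.obj thetaEnd.BN ⟶ thetaEnd.base.obj thetaEnd.BN, IsIso ψ :=
  fun h => not_isIso_φ (h φ)

/-- **Cor. 5.12 (i) FAILS at the datum**: `B_N = B_{N'}`. [cite: MochizukiEtTh2009, Cor 5.12 (i) p.339 (PDF p.113)] -/
theorem not_isoClassesDistinct_rootEnd : ¬ IsoClassesDistinct rootEnd := fun h => h.2.2.false (Iso.refl Bo)

/-- **`hEnd` cannot be dropped from `RootMorphismData.isoClassesDistinct_of_model`** (p436682): the remaining
binders — operations = the model's, `Φ` divisorial, `A_N` Frobenius-trivial, `B_N` Aut-ample, the class of `B_N` not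
principal, no positive power of the class of `B_{N'}` principal (print's named inputs, Cor. 5.12 proof p.340–341) —
do NOT imply "the isomorphism classes of `A_N`, `B_N`, `B_{N'}` are distinct": kernel counter-model `rootEnd`.
[cite: MochizukiEtTh2009, Cor 5.12 (i) p.339–341 (PDF pp.113–115)] -/
theorem not_isoClassesDistinct_of_model_without_hEnd :
    ¬ ∀ (D₀ : Type) [Category.{0} D₀] (Φ₀ B₀ : D₀ᵒᵖ ⥤ CommMonCat.{0}) (DivB₀ : B₀ ⟶ monoidGp Φ₀)
        (𝔉 : ThetaFrobenioid.{0} (ModelFrobenioid Φ₀ B₀ DivB₀) D₀)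
        (V : FrobenioidThetaBiKummer.BiKummerVocabStub 𝔉) (R : RootMorphismData 𝔉 V),
        𝔉.pre = PreFrobenioidData.ofModel Φ₀ B₀ DivB₀ →
        Objectwise (fun M _ => IsDivisorial M) Φ₀ →
        𝔉.IsFrobeniusTrivial 𝔉.AN → 𝔉.AutAmpleBN →
        (∀ u : B₀.obj (op 𝔉.BN.base), 𝔉.BN.cls ≠ divB Φ₀ B₀ DivB₀ (op 𝔉.BN.base) u) →
        (∀ k : ℕ, 0 < k → ∀ u : B₀.obj (op R.BN'.base),
          R.BN'.cls ^ k ≠ divB Φ₀ B₀ DivB₀ (op R.BN'.base) u) →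
        IsoClassesDistinct R :=
  fun h => not_isoClassesDistinct_rootEnd
    (h D Φpow B DivB thetaEnd vocabEnd rootEnd thetaEnd_pre isDivisorial_Φpow isFrobeniusTrivial_A autAmpleBN_End
      cls_B_ne cls_B_pow_ne)

end Cor512EndToy

end ConstantMultiple

end Literature.AnabelianGeometry.EtaleTheta

end
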